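import Summits.MatrixMultiplication.MatrixMultiplication.Theses.AsymptoticRankCW
import Literature.Computability.AlgebraicComplexity.AsymptoticRankLimit
import Literature.Computability.AlgebraicComplexity.BorderRankCWProofs
import Literature.Barriers.MatrixMultiplication.IrreversibilityBarrierThm19

/-!
# MatrixMultiplication / AsymptoticRankCW — the permanent form of the thesis (`BPerm3Form`)

Route `MatrixMultiplication/AsymptoticRankCW`, item `stmt-MatrixMultiplication-1900` (support):
`X_B ↔ R̃(perm₃) = 9`, where `X_B = BThesis` is the growth form
`∀ ε > 0, R(T_cw,2^{⊗N}) = O(3^{(1+ε)N})` of "`R̃(T_cw,2) ≤ 3`", and `perm₃ ∈ ℂ⁹ ⊗ ℂ⁹ ⊗ ℂ⁹` is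
inlined as `(1/6)·[a₁,b₁,c₁ pairwise distinct]·[a₂,b₂,c₂ pairwise distinct]` on `(Fin 3 × Fin 3)³`
(extensionally the tree's `perm3Tensor`, `perm3Inline_eq_perm3Tensor`).

Proof, all ingredients from the tree:
* growth form ↔ `R̃(t) ≤ ρ` (`asymptoticRank_le_of_forall_isBigO`: the infimum
  `R̃ ≤ R(t^{⊗N})^{1/N} ≤ C^{1/N} ρ^{1+ε}` and `N → ∞`, `ε → 0`; `isBigO_of_asymptoticRank_le`: Fekete's
  limit form `advxxz2025_asymptoticRank_tendsto`, `R(t^{⊗N})^{1/N} → R̃(t) < ρ^{1+ε}`);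
* `R̃(t^{⊗k}) = R̃(t)^k` (`asymptoticRank_kroneckerPow_le` and, from the infimum,
  `pow_asymptoticRank_le_asymptoticRank_kroneckerPow`);
* `R̃` is invariant under restriction-equivalence (`asymptoticRank_le_of_polyDegeneratesTo`), in
  particular under changes of bases, reindexing and non-zero scalars;
* `T_cw,2 ≅ 2∑_{σ ∈ 𝔖₃} a_{σ(0)} ⊗ b_{σ(1)} ⊗ c_{σ(2)}` (Conner–Gesmundo–Landsberg–Ventura 2022, §3.2:
  `cglv_exists_basis_cwTensor_two`, and the explicit inverse change of basis
  `levi_restrictsTo_cwTensor`), whence `T_cw,2^{⊠2} ≅ perm₃` (CGLV Lemma 2.4) and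
  `R̃(perm₃) = R̃(T_cw,2)²` (`asymptoticRank_perm3Tensor`);
* `3 = ζ⁽¹⁾(T_cw,2) ≤ R̃(T_cw,2)` (`flatteningRank_cwTensor`, `flatteningRank_le_asymptoticRank`).
Hence `X_B ↔ R̃(T_cw,2) ≤ 3 ↔ R̃(T_cw,2) = 3 ↔ R̃(perm₃) = 9` (`bPerm3Form_proof`).

References: A. Conner, F. Gesmundo, J. M. Landsberg, E. Ventura, comput. complexity 31 (2022) =
arXiv:1909.04785, Lemma 2.4 and §3.2; M. Christandl, P. Vrana, J. Zuiddam, JAMS 36 (2023), §1.1;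
J. Alman et al., SODA 2025 (arXiv:2404.16349), §3.2 (Fekete).
-/

noncomputable section

open scoped BigOperators
open Filter Asymptotics Topology

-- the problem's namespace `Summit.MatrixMultiplication.MatrixMultiplication` repeats the summit name
set_option linter.dupNamespace false

namespace Summit.MatrixMultiplication.MatrixMultiplication.Theorems

open Literature.Computability.AlgebraicComplexity
open Literature.Barriers.MatrixMultiplication (asymptoticRank_le_rpow flatteningRank_le_asymptoticRank
  asymptoticRank_kroneckerPow_le asymptoticRank_le_of_polyDegeneratesTo tensorRank_kroneckerPow_mul
  flatteningRank_cwTensor)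

/-! ## General facts on the asymptotic rank -/

section General

variable {ι κ μ ι' κ' μ' : Type} [Fintype ι] [Fintype κ] [Fintype μ] [Fintype ι'] [Fintype κ']
  [Fintype μ'] [DecidableEq ι] [DecidableEq κ] [DecidableEq μ] [DecidableEq ι'] [DecidableEq κ']
  [DecidableEq μ']

/-- Restriction-equivalent tensors (`t ≥ s` and `s ≥ t`) have the same asymptotic rank
(`R̃` is monotone under restriction, indeed under degeneration; Christandl–Vrana–Zuiddam 2023, §1.1).
[folklore] -/
theorem asymptoticRank_eq_of_restrictsTo {t : ι → κ → μ → ℂ} {s : ι' → κ' → μ' → ℂ}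
    (h₁ : TensorRestrictsTo t s) (h₂ : TensorRestrictsTo s t) :
    asymptoticRank s = asymptoticRank t :=
  le_antisymm (asymptoticRank_le_of_polyDegeneratesTo h₁.polyDegeneratesTo)
    (asymptoticRank_le_of_polyDegeneratesTo h₂.polyDegeneratesTo)

omit [Fintype ι'] [Fintype κ'] [Fintype μ'] [DecidableEq ι'] [DecidableEq κ'] [DecidableEq μ'] in
/-- Scaling by a constant is a restriction: `t ≥ r·t` (matrices `r·1, 1, 1`). [folklore] -/
theorem tensorRestrictsTo_const_mul (t : ι → κ → μ → ℂ) (r : ℂ) :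
    TensorRestrictsTo t (fun a b c => r * t a b c) := by
  refine ⟨fun a' a => if a = a' then r else 0, fun b' b => if b = b' then 1 else 0,
    fun c' c => if c = c' then 1 else 0, fun a' b' c' => ?_⟩
  rw [Finset.sum_eq_single a' (fun a _ ha => by simp [ha]) (by simp),
    Finset.sum_eq_single b' (fun b _ hb => by simp [hb]) (by simp),
    Finset.sum_eq_single c' (fun c _ hc => by simp [hc]) (by simp)]
  simp

omit [Fintype ι'] [Fintype κ'] [Fintype μ'] [DecidableEq ι'] [DecidableEq κ'] [DecidableEq μ'] in
/-- Scaling by a non-zero constant is a restriction in the other direction too: `r·t ≥ t`.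
[folklore] -/
theorem tensorRestrictsTo_of_const_mul (t : ι → κ → μ → ℂ) {r : ℂ} (hr : r ≠ 0) :
    TensorRestrictsTo (fun a b c => r * t a b c) t := by
  have h := tensorRestrictsTo_const_mul (fun a b c => r * t a b c) r⁻¹
  have e : (fun a b c => r⁻¹ * (r * t a b c)) = t := by
    funext a b c
    rw [← mul_assoc, inv_mul_cancel₀ hr, one_mul]
  rwa [e] at h

omit [DecidableEq ι] [DecidableEq κ] [DecidableEq μ] [Fintype ι'] [Fintype κ'] [Fintype μ']
  [DecidableEq ι'] [DecidableEq κ'] [DecidableEq μ'] in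
/-- **`R̃(t)^k ≤ R̃(t^{⊗k})`** (`k ≥ 1`): from the infimum, `R̃(t) ≤ R(t^{⊗(Nk)})^{1/(Nk)} =
(R((t^{⊗k})^{⊗N})^{1/N})^{1/k}` for every `N ≥ 1` (Christandl–Vrana–Zuiddam 2023, §1.1; with
`asymptoticRank_kroneckerPow_le` this is `R̃(t^{⊗k}) = R̃(t)^k`). [folklore] -/
theorem pow_asymptoticRank_le_asymptoticRank_kroneckerPow (t : ι → κ → μ → ℂ) {k : ℕ}
    (hk : 0 < k) : asymptoticRank t ^ k ≤ asymptoticRank (kroneckerPow t k) := by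
  have h0 : 0 ≤ asymptoticRank t := asymptoticRank_nonneg t
  have hk0 : (k : ℝ) ≠ 0 := by exact_mod_cast hk.ne'
  refine le_ciInf fun N => ?_
  have hkN : 0 < (N + 1) * k := Nat.mul_pos (Nat.succ_pos N) hk
  have h1 := asymptoticRank_le_rpow t hkN
  rw [tensorRank_kroneckerPow_mul t (N + 1) k] at h1
  calc asymptoticRank t ^ k
      ≤ (((tensorRank (kroneckerPow (kroneckerPow t k) (N + 1)) : ℝ)) ^
          ((((N + 1) * k : ℕ) : ℝ))⁻¹) ^ k := pow_le_pow_left₀ h0 h1 k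
    _ = (tensorRank (kroneckerPow (kroneckerPow t k) (N + 1)) : ℝ) ^ ((N : ℝ) + 1)⁻¹ := by
        rw [← Real.rpow_natCast, ← Real.rpow_mul (Nat.cast_nonneg _)]
        congr 1
        push_cast
        rw [mul_inv, inv_mul_cancel_right₀ hk0]

omit [DecidableEq ι] [DecidableEq κ] [DecidableEq μ] [Fintype ι'] [Fintype κ'] [Fintype μ']
  [DecidableEq ι'] [DecidableEq κ'] [DecidableEq μ'] in
/-- **From the growth form to the asymptotic rank**: if `R(t^{⊗N}) = O(ρ^{(1+ε)N})` for every
`ε > 0` (`ρ > 0`), then `R̃(t) ≤ ρ` — since `R̃(t) ≤ R(t^{⊗N})^{1/N} ≤ C_ε^{1/N} ρ^{1+ε}` for all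
`N ≥ 1`, and `N → ∞`, `ε → 0` (Christandl–Vrana–Zuiddam 2023, §1.1: `R̃` is the infimum). [folklore] -/
theorem asymptoticRank_le_of_forall_isBigO (t : ι → κ → μ → ℂ) {ρ : ℝ} (hρ : 0 < ρ)
    (h : ∀ ε : ℝ, 0 < ε → (fun N : ℕ => (tensorRank (kroneckerPow t N) : ℝ)) =O[atTop]
      fun N : ℕ => ρ ^ ((1 + ε) * N)) :
    asymptoticRank t ≤ ρ := by
  -- for every `ε > 0`: `R̃(t) ≤ ρ^{1+ε}`
  have step : ∀ ε : ℝ, 0 < ε → asymptoticRank t ≤ ρ ^ (1 + ε) := by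
    intro ε hε
    obtain ⟨C, hC, hb⟩ := bound_of_isBigO_nat_atTop (h ε hε)
    have hN : ∀ N : ℕ, 0 < N → asymptoticRank t ≤ C ^ ((N : ℝ)⁻¹) * ρ ^ (1 + ε) := by
      intro N hN
      have hN0 : (N : ℝ) ≠ 0 := by exact_mod_cast hN.ne'
      have h2 : (tensorRank (kroneckerPow t N) : ℝ) ≤ C * ρ ^ ((1 + ε) * N) := by
        have hg : ρ ^ ((1 + ε) * N) ≠ 0 := (Real.rpow_pos_of_pos hρ _).ne'
        have := hb hg
        rwa [Real.norm_of_nonneg (Nat.cast_nonneg _),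
          Real.norm_of_nonneg (Real.rpow_pos_of_pos hρ _).le] at this
      calc asymptoticRank t ≤ (tensorRank (kroneckerPow t N) : ℝ) ^ ((N : ℝ)⁻¹) :=
            asymptoticRank_le_rpow t hN
        _ ≤ (C * ρ ^ ((1 + ε) * N)) ^ ((N : ℝ)⁻¹) :=
            Real.rpow_le_rpow (Nat.cast_nonneg _) h2 (by positivity)
        _ = C ^ ((N : ℝ)⁻¹) * ρ ^ (1 + ε) := by
            rw [Real.mul_rpow hC.le (Real.rpow_nonneg hρ.le _), ← Real.rpow_mul hρ.le,
              mul_assoc, mul_inv_cancel₀ hN0, mul_one]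
    have hc : Tendsto (fun N : ℕ => C ^ ((N : ℝ)⁻¹)) atTop (𝓝 (C ^ (0 : ℝ))) :=
      ((Real.continuousAt_const_rpow hC.ne').tendsto).comp tendsto_inv_atTop_nhds_zero_nat
    rw [Real.rpow_zero] at hc
    have hlim : Tendsto (fun N : ℕ => C ^ ((N : ℝ)⁻¹) * ρ ^ (1 + ε)) atTop
        (𝓝 (1 * ρ ^ (1 + ε))) := hc.mul_const _
    rw [one_mul] at hlim
    exact ge_of_tendsto hlim (by
      filter_upwards [eventually_gt_atTop 0] with N hN0 using hN N hN0)
  -- `ε → 0` along `ε = 1/(n+1)`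
  have h1 : Tendsto (fun n : ℕ => (1 : ℝ) + 1 / ((n : ℝ) + 1)) atTop (𝓝 ((1 : ℝ) + 0)) :=
    tendsto_const_nhds.add tendsto_one_div_add_atTop_nhds_zero_nat
  rw [add_zero] at h1
  have hlim2 : Tendsto (fun n : ℕ => ρ ^ ((1 : ℝ) + 1 / ((n : ℝ) + 1))) atTop
      (𝓝 (ρ ^ (1 : ℝ))) :=
    ((Real.continuousAt_const_rpow hρ.ne').tendsto).comp h1
  rw [Real.rpow_one] at hlim2
  exact ge_of_tendsto hlim2 (Filter.Eventually.of_forall fun n => step _ (by positivity))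

omit [DecidableEq ι] [DecidableEq κ] [DecidableEq μ] [Fintype ι'] [Fintype κ'] [Fintype μ']
  [DecidableEq ι'] [DecidableEq κ'] [DecidableEq μ'] in
/-- **From the asymptotic rank to the growth form**: if `R̃(t) ≤ ρ` with `ρ > 1`, then
`R(t^{⊗N}) = O(ρ^{(1+ε)N})` for every `ε > 0` — by Fekete's limit form
`R(t^{⊗N})^{1/N} → R̃(t)` (`advxxz2025_asymptoticRank_tendsto`), eventually
`R(t^{⊗N})^{1/N} < ρ^{1+ε}`. [folklore] -/
theorem isBigO_of_asymptoticRank_le (t : ι → κ → μ → ℂ) {ρ : ℝ} (hρ : 1 < ρ)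
    (h : asymptoticRank t ≤ ρ) {ε : ℝ} (hε : 0 < ε) :
    (fun N : ℕ => (tensorRank (kroneckerPow t N) : ℝ)) =O[atTop]
      fun N : ℕ => ρ ^ ((1 + ε) * N) := by
  have hρ0 : 0 < ρ := by linarith
  have hlt : asymptoticRank t < ρ ^ (1 + ε) := by
    calc asymptoticRank t ≤ ρ := h
      _ = ρ ^ (1 : ℝ) := (Real.rpow_one ρ).symm
      _ < ρ ^ (1 + ε) := Real.rpow_lt_rpow_of_exponent_lt hρ (by linarith)
  have hev : ∀ᶠ n : ℕ in atTop,
      (tensorRank (kroneckerPow t n) : ℝ) ^ ((n : ℝ)⁻¹) < ρ ^ (1 + ε) :=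
    (advxxz2025_asymptoticRank_tendsto t).eventually_lt_const hlt
  refine IsBigO.of_bound 1 ?_
  filter_upwards [hev, eventually_gt_atTop 0] with n hn hn0
  rw [Real.norm_of_nonneg (Nat.cast_nonneg _),
    Real.norm_of_nonneg (Real.rpow_pos_of_pos hρ0 _).le, one_mul]
  have hR0 : (0 : ℝ) ≤ tensorRank (kroneckerPow t n) := Nat.cast_nonneg _
  have hn' : (0 : ℝ) < n := by exact_mod_cast hn0
  have key : ((tensorRank (kroneckerPow t n) : ℝ) ^ ((n : ℝ)⁻¹)) ^ (n : ℝ) ≤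
      (ρ ^ (1 + ε)) ^ (n : ℝ) :=
    Real.rpow_le_rpow (by positivity) hn.le hn'.le
  rwa [← Real.rpow_mul hR0, inv_mul_cancel₀ hn'.ne', Real.rpow_one, ← Real.rpow_mul hρ0.le]
    at key

end General

/-! ## `T_cw,2`, the tensor `2∑_σ a_{σ(0)} ⊗ b_{σ(1)} ⊗ c_{σ(2)}`, and `perm₃` -/

section Perm

/-- `|ε_{ijk}|` is the indicator of "`i, j, k` pairwise distinct". [folklore] -/
theorem abs_leviCivita3 (i j k : Fin 3) :
    (|leviCivita3 i j k| : ℤ) = if (i ≠ j ∧ j ≠ k ∧ i ≠ k) then 1 else 0 := by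
  rw [leviCivita3_eq_table]
  fin_cases i <;> fin_cases j <;> fin_cases k <;> decide

/-- CGLV §3.2 (the `T_cw,2` half of Lemma 2.4): `T_cw,2` restricts to the tensor with entries
`2|ε_{ijk}|`, i.e. `2∑_{σ ∈ 𝔖₃} a_{σ(0)} ⊗ b_{σ(1)} ⊗ c_{σ(2)} = (A, A, A)·T_cw,2`.
[cite: ConnerGesmundoLandsbergVentura2022, §3.2 (proof of Lemma 2.4)] -/
theorem cwTensor_restrictsTo_levi :
    TensorRestrictsTo (cwTensor ℂ 2)
      (fun i j k : Fin 3 => 2 * ((|leviCivita3 i j k| : ℤ) : ℂ)) := by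
  obtain ⟨A, -, hA⟩ := cglv_exists_basis_cwTensor_two
  exact ⟨A, A, A, fun i j k => (hA i j k).symm⟩

/-- The inverse change of basis: with `B = A⁻¹` (`A` the matrix of CGLV §3.2, columns `a₀ ↦ a₀`,
`a₁ ↦ a₁ + a₂`, `a₂ ↦ -i a₁ + i a₂`; `B` has rows `(1,0,0)`, `(0,1/2,1/2)`, `(0,i/2,-i/2)`),
`(B, B, B)·(2∑_σ a_{σ(0)} ⊗ b_{σ(1)} ⊗ c_{σ(2)}) = T_cw,2`, so the two tensors are isomorphic.
[cite: ConnerGesmundoLandsbergVentura2022, §3.2 (proof of Lemma 2.4)] -/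
theorem levi_restrictsTo_cwTensor :
    TensorRestrictsTo (fun i j k : Fin 3 => 2 * ((|leviCivita3 i j k| : ℤ) : ℂ))
      (cwTensor ℂ 2) := by
  refine ⟨!![1, 0, 0; 0, 1 / 2, 1 / 2; 0, Complex.I / 2, -Complex.I / 2],
    !![1, 0, 0; 0, 1 / 2, 1 / 2; 0, Complex.I / 2, -Complex.I / 2],
    !![1, 0, 0; 0, 1 / 2, 1 / 2; 0, Complex.I / 2, -Complex.I / 2], fun i j k => ?_⟩
  fin_cases i <;> fin_cases j <;> fin_cases k <;>
    (simp [Fin.sum_univ_three, cwTensor, abs_leviCivita3]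
     try ring_nf
     try simp [Complex.I_sq]
     try ring_nf)

/-- `perm₃ = (1/24) · (2|ε|) ⊠ (2|ε|)` (entries `(1/6)|ε_{a₁b₁c₁}||ε_{a₂b₂c₂}|`).
[cite: ConnerGesmundoLandsbergVentura2022, Lemma 2.4] -/
theorem perm3Tensor_eq_const_mul_kronecker :
    perm3Tensor = fun a b c => (1 / 24 : ℂ) *
      kroneckerTensor (fun i j k : Fin 3 => 2 * ((|leviCivita3 i j k| : ℤ) : ℂ))
        (fun i j k : Fin 3 => 2 * ((|leviCivita3 i j k| : ℤ) : ℂ)) a b c := by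
  funext a b c
  simp only [perm3Tensor, kroneckerTensor_apply, Int.cast_mul]
  ring

/-- The route's inlined `perm₃` — `(1/6)·[a₁,b₁,c₁ pairwise distinct]·[a₂,b₂,c₂ pairwise distinct]`
— is the tree's `perm3Tensor = (1/6)|ε_{a₁b₁c₁}||ε_{a₂b₂c₂}|`.
[cite: ConnerGesmundoLandsbergVentura2022, Lemma 2.4] -/
theorem perm3Inline_eq_perm3Tensor :
    (fun a b c : Fin 3 × Fin 3 => if (a.1 ≠ b.1 ∧ b.1 ≠ c.1 ∧ a.1 ≠ c.1 ∧ a.2 ≠ b.2 ∧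
      b.2 ≠ c.2 ∧ a.2 ≠ c.2) then (1 / 6 : ℂ) else 0) = perm3Tensor := by
  funext a b c
  simp only [perm3Tensor, abs_leviCivita3, Int.cast_mul, Int.cast_ite, Int.cast_one,
    Int.cast_zero]
  by_cases p1 : a.1 = b.1 <;> by_cases p2 : b.1 = c.1 <;> by_cases p3 : a.1 = c.1 <;>
    by_cases p4 : a.2 = b.2 <;> by_cases p5 : b.2 = c.2 <;> by_cases p6 : a.2 = c.2 <;>
    simp [p1, p2, p3, p4, p5, p6]

/-- The reindexed Kronecker square of `T_cw,2` is the Kronecker product `T_cw,2 ⊠ T_cw,2` on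
`(Fin 3 × Fin 3)³`. [folklore] -/
theorem squareReindex_kroneckerPow_cwTensor :
    squareReindex (kroneckerPow (cwTensor ℂ 2) 2) =
      kroneckerTensor (cwTensor ℂ 2) (cwTensor ℂ 2) := by
  funext a b c
  rw [squareReindex_kroneckerPow_two, kroneckerTensor_apply]

/-- Reindexing the square along `finTwoArrowEquiv` is a restriction in both directions. [folklore] -/
theorem restrictsTo_squareReindex (t : (Fin 2 → Fin 3) → (Fin 2 → Fin 3) → (Fin 2 → Fin 3) → ℂ) :
    TensorRestrictsTo t (squareReindex t) ∧ TensorRestrictsTo (squareReindex t) t :=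
  ⟨tensorRestrictsTo_precomp t (finTwoArrowEquiv (Fin 3)).symm (finTwoArrowEquiv (Fin 3)).symm
      (finTwoArrowEquiv (Fin 3)).symm,
    tensorRestrictsTo_of_reindex t (finTwoArrowEquiv (Fin 3)).symm (finTwoArrowEquiv (Fin 3)).symm
      (finTwoArrowEquiv (Fin 3)).symm⟩

/-- **`R̃(perm₃) = R̃(T_cw,2)²`**: `perm₃ ≅ T_cw,2^{⊠2}` (CGLV Lemma 2.4: non-zero scalar, the
changes of bases factorwise, reindexing — all restriction-equivalences, under which `R̃` is
invariant) and `R̃(t^{⊗2}) = R̃(t)²`. [cite: ConnerGesmundoLandsbergVentura2022, Lemma 2.4] -/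
theorem asymptoticRank_perm3Tensor :
    asymptoticRank perm3Tensor = asymptoticRank (cwTensor ℂ 2) ^ 2 := by
  have h1 : asymptoticRank perm3Tensor = asymptoticRank
      (kroneckerTensor (fun i j k : Fin 3 => 2 * ((|leviCivita3 i j k| : ℤ) : ℂ))
        (fun i j k : Fin 3 => 2 * ((|leviCivita3 i j k| : ℤ) : ℂ))) := by
    rw [perm3Tensor_eq_const_mul_kronecker]
    exact asymptoticRank_eq_of_restrictsTo (tensorRestrictsTo_const_mul _ _)
      (tensorRestrictsTo_of_const_mul _ (by norm_num))
  have h2 : asymptoticRank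
      (kroneckerTensor (fun i j k : Fin 3 => 2 * ((|leviCivita3 i j k| : ℤ) : ℂ))
        (fun i j k : Fin 3 => 2 * ((|leviCivita3 i j k| : ℤ) : ℂ))) =
      asymptoticRank (kroneckerTensor (cwTensor ℂ 2) (cwTensor ℂ 2)) :=
    asymptoticRank_eq_of_restrictsTo (cwTensor_restrictsTo_levi.kronecker cwTensor_restrictsTo_levi)
      (levi_restrictsTo_cwTensor.kronecker levi_restrictsTo_cwTensor)
  have h3 : asymptoticRank (kroneckerTensor (cwTensor ℂ 2) (cwTensor ℂ 2)) =
      asymptoticRank (kroneckerPow (cwTensor ℂ 2) 2) := by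
    rw [← squareReindex_kroneckerPow_cwTensor]
    exact asymptoticRank_eq_of_restrictsTo (restrictsTo_squareReindex _).1
      (restrictsTo_squareReindex _).2
  have h4 : asymptoticRank (kroneckerPow (cwTensor ℂ 2) 2) = asymptoticRank (cwTensor ℂ 2) ^ 2 :=
    le_antisymm (asymptoticRank_kroneckerPow_le _ (by norm_num))
      (pow_asymptoticRank_le_asymptoticRank_kroneckerPow _ (by norm_num))
  rw [h1, h2, h3, h4]

/-- `3 = ζ⁽¹⁾(T_cw,2) ≤ R̃(T_cw,2)` (flattening lower bound). [folklore] -/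
theorem three_le_asymptoticRank_cwTensor_two : (3 : ℝ) ≤ asymptoticRank (cwTensor ℂ 2) := by
  have h := flatteningRank_le_asymptoticRank (cwTensor ℂ 2)
  rw [flatteningRank_cwTensor (by norm_num)] at h
  exact_mod_cast h

end Perm

/-! ## The item -/

/-- **`BPerm3Form`** (item `stmt-MatrixMultiplication-1900`): `X_B ↔ R̃(perm₃) = 9`. With
`R̃(perm₃) = R̃(T_cw,2)²` and `R̃(T_cw,2) ≥ 3`: the growth form `X_B` says `R̃(T_cw,2) ≤ 3`, i.e.
`R̃(T_cw,2) = 3`, i.e. `R̃(perm₃) = 9`. [cite: ConnerGesmundoLandsbergVentura2022, Lemma 2.4] -/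
theorem bPerm3Form_proof :
    Summit.MatrixMultiplication.MatrixMultiplication.Theses.AsymptoticRankCW.BPerm3Form := by
  unfold Summit.MatrixMultiplication.MatrixMultiplication.Theses.AsymptoticRankCW.BPerm3Form
    Summit.MatrixMultiplication.MatrixMultiplication.Theses.AsymptoticRankCW.BThesis
  rw [perm3Inline_eq_perm3Tensor, asymptoticRank_perm3Tensor]
  have h3 := three_le_asymptoticRank_cwTensor_two
  constructor
  · intro hX
    have hle : asymptoticRank (cwTensor ℂ 2) ≤ 3 :=
      asymptoticRank_le_of_forall_isBigO (cwTensor ℂ 2) (by norm_num) hX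
    rw [le_antisymm hle h3]
    norm_num
  · intro h9 ε hε
    have heq : asymptoticRank (cwTensor ℂ 2) = 3 := by
      nlinarith [asymptoticRank_nonneg (cwTensor ℂ 2)]
    exact isBigO_of_asymptoticRank_le (cwTensor ℂ 2) (by norm_num) heq.le hε

end Summit.MatrixMultiplication.MatrixMultiplication.Theorems

end
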